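import Mathlib
import HarnessLib
import Summits.AtomisticToContinuum.Crystallization.Theorems.PricedLinkCensusSoftLayerPropagationStubBallPropagationLayers
import Summits.AtomisticToContinuum.Crystallization.Theorems.PricedLinkCensusSoftLayerPropagationStubBallPropagationHoles
import Summits.AtomisticToContinuum.Crystallization.Theorems.PricedLinkCensusSoftLayerPropagationStubBallPropagationFccZone

/-!
# Local layer-propagation lemmas for the finite-ball form of Hales, *Dense Sphere Packings* §1.3 (III)

Route `PricedLinkCensus`, crux `SoftLayerPropagation` (stmt-AtomisticToContinuum-14233), line
`Sketch`, third helper file for the stub `stub_ballPropagation` (frame `u₁ = triangularVec₁ 2`,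
`u₂ = triangularVec₂ 2`, `w = barlowOffset 2`, `𝗁 e₃ = layerNormal layerSpacing` of
`LayerShells.lean`), assembling `…Layers.lean`, `…Holes.lean` (and the small frame lemmas of
`…FccZone.lean`) into the steps a layer-by-layer reconstruction of the packing on a ball uses:

* `hexagonSet_subset_kissingShell_above` / `…_below` — for a centre `p` with shell
  `layerShell σ σ′`, a hole point `t ∈ holeTriple σ` (resp. `σ′`), the far corner `p + 3t` occupied
  and a pattern shell at the centre `p + t ± 𝗁 e₃` above (below) `p`: that shell contains the
  standard hexagon (`hexagonSet_subset_kissingShell_of_holeTriple`);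
* `exists_kissingShell_above_eq_layerShell` / `…_below_…` — hence (`IsTwelveConfig.eq_layerShell`)
  it is a layer shell `layerShell τ (−σ)` (resp. `layerShell (−σ′) τ′`): the type on the side of
  `p` is forced by the position of `p` (the two hole triples are disjoint,
  `eq_of_mem_holeTriple_of_mem_holeTriple`), the type on the far side is free — it is the next
  letter of the Hägg word;
* `exists_mem_holeTriple_norm_sq_add_le_two` — a horizontal `p` with `‖p‖² ≤ 2` has a hole point
  `t ∈ holeTriple τ` with `‖p + t‖² ≤ 2` (of the three centres above a full centre within `√2` of
  the axis of the ball, one is again within `√2` of the axis: the seed of the next layer's disc);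
* `inter_closedBall_eq_image_barlowStacking_inter` — NO ROOM on a ball: if every point of a moved
  close-packed stacking `g '' barlowStacking 2 𝗁 s` within distance `< R + 2` of `u` is a centre
  of the packing `V`, then `V` and the moved stacking agree on `closedBall u R`
  (`exists_dist_barlowPos_lt_two`: every point of space is within `< 2` of the stacking) — the
  final step of the finite-ball statement, reducing it to "the stacking points of the
  `(R + 2)`-ball are centres".

All statements are elementary ([folklore]).
-/

noncomputable section

namespace Summit.AtomisticToContinuum.Crystallization.Theorems

open Literature.Geometry.DiscreteGeometry Literature.MathematicalPhysics.StatisticalMechanics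
open RealInnerProductSpace

/-! ### The centres above and below a centre with a layer shell -/

/-- **Upward step.**  If the centre `p` has shell `layerShell σ σ′`, `t ∈ holeTriple σ` (so
`p + t + 𝗁 e₃` is one of the three centres above `p`), the far corner `p + 3t` is a centre and the
shell of `p + t + 𝗁 e₃` is a pattern, then that shell contains the standard hexagon. [folklore] -/
theorem hexagonSet_subset_kissingShell_above {V : Set (EuclideanSpace ℝ (Fin 3))}
    (hV : IsUnitBallPacking V) {σ σ' : ℝ} (hσ : σ = 1 ∨ σ = -1) {p t : EuclideanSpace ℝ (Fin 3)}
    (hshell : kissingShell V p = layerShell σ σ') (hp : p ∈ V) (ht : t ∈ holeTriple σ)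
    (hfar : p + (3 : ℝ) • t ∈ V)
    (hpat : IsArrangedIn (kissingShell V (p + (t + layerNormal layerSpacing))) fccKissingPattern ∨
      IsArrangedIn (kissingShell V (p + (t + layerNormal layerSpacing))) hcpKissingPattern) :
    hexagonSet ⊆ kissingShell V (p + (t + layerNormal layerSpacing)) := by
  have key := hexagonSet_subset_kissingShell_of_holeTriple hV hσ (s := 1) (Or.inl rfl) hp
    (add_mem_of_kissingShell_eq_layerShell hshell) ht hfar
  rw [one_smul] at key
  exact key hpat

/-- **Downward step** (the mirror image of `hexagonSet_subset_kissingShell_above`). [folklore] -/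
theorem hexagonSet_subset_kissingShell_below {V : Set (EuclideanSpace ℝ (Fin 3))}
    (hV : IsUnitBallPacking V) {σ σ' : ℝ} (hσ' : σ' = 1 ∨ σ' = -1) {p t : EuclideanSpace ℝ (Fin 3)}
    (hshell : kissingShell V p = layerShell σ σ') (hp : p ∈ V) (ht : t ∈ holeTriple σ')
    (hfar : p + (3 : ℝ) • t ∈ V)
    (hpat : IsArrangedIn (kissingShell V (p + (t - layerNormal layerSpacing))) fccKissingPattern ∨
      IsArrangedIn (kissingShell V (p + (t - layerNormal layerSpacing))) hcpKissingPattern) :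
    hexagonSet ⊆ kissingShell V (p + (t - layerNormal layerSpacing)) := by
  have key := hexagonSet_subset_kissingShell_of_holeTriple hV hσ' (s := -1) (Or.inr rfl) hp
    (add_mem_of_kissingShell_eq_layerShell hshell) ht hfar
  rw [neg_one_smul, ← sub_eq_add_neg] at key
  exact key hpat


/-! ### The type of the new shell on the side of the old centre -/

/-- **Upward step with types.**  Under the hypotheses of `hexagonSet_subset_kissingShell_above`
the shell of the upper centre `y = p + t + 𝗁 e₃` is a layer shell `layerShell τ (−σ)`: its type
below is forced by the position of `p = y − t − 𝗁 e₃` (`−t ∈ holeTriple (−σ)`), its type `τ`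
above is free (it is the next letter of the Hägg word). [folklore] -/
theorem exists_kissingShell_above_eq_layerShell {V : Set (EuclideanSpace ℝ (Fin 3))}
    (hV : IsUnitBallPacking V) {σ σ' : ℝ} (hσ : σ = 1 ∨ σ = -1) {p t : EuclideanSpace ℝ (Fin 3)}
    (hshell : kissingShell V p = layerShell σ σ') (hp : p ∈ V) (ht : t ∈ holeTriple σ)
    (hfar : p + (3 : ℝ) • t ∈ V)
    (hpat : IsArrangedIn (kissingShell V (p + (t + layerNormal layerSpacing))) fccKissingPattern ∨
      IsArrangedIn (kissingShell V (p + (t + layerNormal layerSpacing))) hcpKissingPattern) :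
    ∃ τ : ℝ, (τ = 1 ∨ τ = -1) ∧
      kissingShell V (p + (t + layerNormal layerSpacing)) = layerShell τ (-σ) := by
  have hH := hexagonSet_subset_kissingShell_above hV hσ hshell hp ht hfar hpat
  obtain ⟨τ, τ', hτ, hτ', hS⟩ :=
    (isTwelveConfig_kissingShell_of_isArrangedIn hV hpat).eq_layerShell hH
  refine ⟨τ, hτ, ?_⟩
  have hm : -(t + layerNormal layerSpacing) ∈ kissingShell V (p + (t + layerNormal layerSpacing)) :=
    mem_kissingShell_of_inner (by rw [add_neg_cancel_right]; exact hp)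
      (by rw [inner_neg_left, inner_neg_right, neg_neg]
          simpa using inner_self_holeTriple_add_smul_frameE hσ (s := 1) (Or.inl rfl) ht)
  rw [hS] at hm
  have ht2 : t 2 = 0 := apply_two_of_mem_holeTriple ht
  rcases mem_layerShell_iff.1 hm with h | h | h
  · have h0 := apply_two_of_mem_hexagonSet h
    simp only [PiLp.neg_apply, PiLp.add_apply, ht2, frameE_apply_two] at h0
    linarith [layerSpacing_pos]
  · have h0 := apply_two_of_mem_holeTriple h
    simp only [PiLp.sub_apply, PiLp.neg_apply, PiLp.add_apply, ht2, frameE_apply_two] at h0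
    linarith [layerSpacing_pos]
  · have h' : -t ∈ holeTriple τ' := by
      have e : -(t + layerNormal layerSpacing) + layerNormal layerSpacing = -t := by abel
      rw [e] at h; exact h
    rw [neg_mem_holeTriple_iff] at h'
    have hnτ' : -τ' = 1 ∨ -τ' = -1 := by rcases hτ' with rfl | rfl <;> norm_num
    have := eq_of_mem_holeTriple_of_mem_holeTriple hσ hnτ' ht h'
    rw [hS, this, neg_neg]

/-- **Downward step with types** (mirror image). [folklore] -/
theorem exists_kissingShell_below_eq_layerShell {V : Set (EuclideanSpace ℝ (Fin 3))}
    (hV : IsUnitBallPacking V) {σ σ' : ℝ} (hσ' : σ' = 1 ∨ σ' = -1) {p t : EuclideanSpace ℝ (Fin 3)}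
    (hshell : kissingShell V p = layerShell σ σ') (hp : p ∈ V) (ht : t ∈ holeTriple σ')
    (hfar : p + (3 : ℝ) • t ∈ V)
    (hpat : IsArrangedIn (kissingShell V (p + (t - layerNormal layerSpacing))) fccKissingPattern ∨
      IsArrangedIn (kissingShell V (p + (t - layerNormal layerSpacing))) hcpKissingPattern) :
    ∃ τ' : ℝ, (τ' = 1 ∨ τ' = -1) ∧
      kissingShell V (p + (t - layerNormal layerSpacing)) = layerShell (-σ') τ' := by
  have hH := hexagonSet_subset_kissingShell_below hV hσ' hshell hp ht hfar hpat
  obtain ⟨τ, τ', hτ, hτ', hS⟩ :=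
    (isTwelveConfig_kissingShell_of_isArrangedIn hV hpat).eq_layerShell hH
  refine ⟨τ', hτ', ?_⟩
  have hm : -(t - layerNormal layerSpacing) ∈ kissingShell V (p + (t - layerNormal layerSpacing)) :=
    mem_kissingShell_of_inner (by rw [add_neg_cancel_right]; exact hp)
      (by rw [inner_neg_left, inner_neg_right, neg_neg]
          have := inner_self_holeTriple_add_smul_frameE hσ' (s := -1) (Or.inr rfl) ht
          rwa [neg_one_smul, ← sub_eq_add_neg] at this)
  rw [hS] at hm
  have ht2 : t 2 = 0 := apply_two_of_mem_holeTriple ht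
  rcases mem_layerShell_iff.1 hm with h | h | h
  · have h0 := apply_two_of_mem_hexagonSet h
    simp only [PiLp.neg_apply, PiLp.sub_apply, ht2, frameE_apply_two] at h0
    linarith [layerSpacing_pos]
  · have h' : -t ∈ holeTriple τ := by
      have e : -(t - layerNormal layerSpacing) - layerNormal layerSpacing = -t := by abel
      rw [e] at h; exact h
    rw [neg_mem_holeTriple_iff] at h'
    have hnτ : -τ = 1 ∨ -τ = -1 := by rcases hτ with rfl | rfl <;> norm_num
    have := eq_of_mem_holeTriple_of_mem_holeTriple hσ' hnτ ht h'
    rw [hS, this, neg_neg]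
  · have h0 := apply_two_of_mem_holeTriple h
    simp only [PiLp.add_apply, PiLp.neg_apply, PiLp.sub_apply, ht2, frameE_apply_two] at h0
    linarith [layerSpacing_pos]

/-! ### Choosing the centre above nearest to an axis -/

/-- If `x ≤ y`, `x ≤ z` and `x + y + z = 0` then `y² + z² ≤ 5x²` (`(y − x)(z − x) ≥ 0`). [folklore] -/
theorem sq_add_sq_le_five_mul_sq {x y z : ℝ} (h : x + y + z = 0) (hxy : x ≤ y) (hxz : x ≤ z) :
    y ^ 2 + z ^ 2 ≤ 5 * x ^ 2 := by
  have hz : z = -x - y := by linarith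
  rw [hz] at hxz ⊢
  nlinarith [mul_nonneg (sub_nonneg.2 hxy) (sub_nonneg.2 hxz)]

/-- The quadratic step: `n ≤ 2`, `x ≤ 0`, `n ≤ 3x²` give `n + 2x + 4/3 ≤ 2`. [folklore] -/
theorem add_two_mul_add_le_two {n x : ℝ} (hn0 : 0 ≤ n) (hn : n ≤ 2) (hx : x ≤ 0) (hxn : n ≤ 3 * x ^ 2) :
    n + 2 * x + 4 / 3 ≤ 2 := by
  rcases le_or_gt n (2 / 3) with h | h
  · linarith
  · have h1 : (n / 2 - 1 / 3) ^ 2 ≤ n / 3 := by nlinarith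
    have h2 : (n / 2 - 1 / 3) ^ 2 ≤ x ^ 2 := by linarith
    have habs := sq_le_sq.1 h2
    rw [abs_of_nonneg (by linarith), abs_of_nonpos hx] at habs
    linarith

/-- **The centre above nearest to the axis.**  For a horizontal `p` with `‖p‖² ≤ 2` and a type
`τ = ±1`, one of the three hole points `t ∈ holeTriple τ` has `‖p + t‖² ≤ 2`: the three inner
products `⟪p, t⟫` sum to `0` and their squares to `2‖p‖²`, so the least of them is `≤ −‖p‖/√3`
(`sq_add_sq_le_five_mul_sq`), and `‖p‖² − 2‖p‖/√3 + 4/3 ≤ 2` for `‖p‖ ≤ √2`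
(`add_two_mul_add_le_two`).  Along a layer-by-layer reconstruction this keeps a full centre within
`√2` of the axis of the ball in every layer (the seed of the next disc). [folklore] -/
theorem exists_mem_holeTriple_norm_sq_add_le_two {p : EuclideanSpace ℝ (Fin 3)} (hp2 : p 2 = 0)
    (hp : ‖p‖ ^ 2 ≤ 2) {τ : ℝ} (hτ : τ = 1 ∨ τ = -1) : ∃ t ∈ holeTriple τ, ‖p + t‖ ^ 2 ≤ 2 := by
  suffices key : ∀ q : EuclideanSpace ℝ (Fin 3), q 2 = 0 → ‖q‖ ^ 2 ≤ 2 →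
      ∃ t ∈ holeTriple 1, ‖q + t‖ ^ 2 ≤ 2 by
    rcases hτ with rfl | rfl
    · exact key p hp2 hp
    · obtain ⟨t, ht, hle⟩ := key (-p) (by simp [hp2]) (by rwa [norm_neg])
      refine ⟨-t, neg_mem_holeTriple_iff.2 (by simpa using ht), ?_⟩
      have e : p + -t = -(-p + t) := by abel
      rw [e, norm_neg]; exact hle
  intro q hq2 hq
  have hs : Real.sqrt 3 ^ 2 = 3 := sqrt_three_sq
  have hn : ‖q‖ ^ 2 = q 0 ^ 2 + q 1 ^ 2 := by rw [norm_sq_fin3, hq2]; ring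
  -- the three candidates and their inner products with `q`
  have e1 : ‖q + barlowOffset 2‖ ^ 2 =
      q 0 ^ 2 + q 1 ^ 2 + 2 * (q 0 + Real.sqrt 3 / 3 * q 1) + 4 / 3 := by
    rw [norm_sq_fin3]
    simp only [PiLp.add_apply, frameW_apply_zero, frameW_apply_one, frameW_apply_two, hq2]
    linear_combination (1 / 9 : ℝ) * hs
  have e2 : ‖q + (barlowOffset 2 - triangularVec₁ 2)‖ ^ 2 =
      q 0 ^ 2 + q 1 ^ 2 + 2 * (-q 0 + Real.sqrt 3 / 3 * q 1) + 4 / 3 := by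
    rw [norm_sq_fin3]
    simp only [PiLp.add_apply, PiLp.sub_apply, frameW_apply_zero, frameW_apply_one, frameW_apply_two,
      frameU_apply_zero, frameU_apply_one, frameU_apply_two, hq2]
    linear_combination (1 / 9 : ℝ) * hs
  have e3 : ‖q + (barlowOffset 2 - triangularVec₂ 2)‖ ^ 2 =
      q 0 ^ 2 + q 1 ^ 2 + 2 * (-(2 * Real.sqrt 3 / 3) * q 1) + 4 / 3 := by
    rw [norm_sq_fin3]
    simp only [PiLp.add_apply, PiLp.sub_apply, frameW_apply_zero, frameW_apply_one, frameW_apply_two,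
      frameV_apply_zero, frameV_apply_one, frameV_apply_two, hq2]
    linear_combination (4 / 9 : ℝ) * hs
  have hsum : (q 0 + Real.sqrt 3 / 3 * q 1) + (-q 0 + Real.sqrt 3 / 3 * q 1) +
      (-(2 * Real.sqrt 3 / 3) * q 1) = 0 := by ring
  have hsq : (q 0 + Real.sqrt 3 / 3 * q 1) ^ 2 + (-q 0 + Real.sqrt 3 / 3 * q 1) ^ 2 +
      (-(2 * Real.sqrt 3 / 3) * q 1) ^ 2 = 2 * (q 0 ^ 2 + q 1 ^ 2) := by
    linear_combination (2 / 3 * q 1 ^ 2) * hs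
  -- the generic conclusion for the least inner product
  have finish : ∀ t : EuclideanSpace ℝ (Fin 3), t ∈ holeTriple 1 → ∀ x y z : ℝ,
      ‖q + t‖ ^ 2 = q 0 ^ 2 + q 1 ^ 2 + 2 * x + 4 / 3 → x + y + z = 0 →
      x ^ 2 + y ^ 2 + z ^ 2 = 2 * (q 0 ^ 2 + q 1 ^ 2) → x ≤ y → x ≤ z →
      ∃ t ∈ holeTriple 1, ‖q + t‖ ^ 2 ≤ 2 := by
    intro t ht x y z he hxyz hsq' hxy hxz
    refine ⟨t, ht, ?_⟩
    have h5 := sq_add_sq_le_five_mul_sq hxyz hxy hxz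
    have hx0 : x ≤ 0 := by linarith
    have hxn : q 0 ^ 2 + q 1 ^ 2 ≤ 3 * x ^ 2 := by linarith
    rw [he]
    exact add_two_mul_add_le_two (by positivity) (by rw [← hn]; exact hq) hx0 hxn
  have m1 : (barlowOffset 2 : EuclideanSpace ℝ (Fin 3)) ∈ holeTriple 1 := by simp [holeTriple]
  have m2 : (barlowOffset 2 - triangularVec₁ 2 : EuclideanSpace ℝ (Fin 3)) ∈ holeTriple 1 := by
    simp [holeTriple]
  have m3 : (barlowOffset 2 - triangularVec₂ 2 : EuclideanSpace ℝ (Fin 3)) ∈ holeTriple 1 := by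
    simp [holeTriple]
  set x₁ := q 0 + Real.sqrt 3 / 3 * q 1 with hx₁
  set x₂ := -q 0 + Real.sqrt 3 / 3 * q 1 with hx₂
  set x₃ := -(2 * Real.sqrt 3 / 3) * q 1 with hx₃
  rcases le_or_gt x₁ x₂ with h12 | h12
  · rcases le_or_gt x₁ x₃ with h13 | h13
    · exact finish _ m1 x₁ x₂ x₃ e1 hsum hsq h12 h13
    · exact finish _ m3 x₃ x₁ x₂ e3 (by linarith) (by linarith) h13.le (by linarith)
  · rcases le_or_gt x₂ x₃ with h23 | h23
    · exact finish _ m2 x₂ x₁ x₃ e2 (by linarith) (by linarith) h12.le h23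
    · exact finish _ m3 x₃ x₁ x₂ e3 (by linarith) (by linarith) (by linarith) h23.le

/-! ### No room on a ball -/

/-- **No room on a ball.**  Let `V` be a packing of unit balls and `g` an isometry of `ℝ³`.  If
every point of the moved close-packed stacking `g '' barlowStacking 2 𝗁 s` at distance `< R + 2`
from `u` belongs to `V`, then `V ∩ closedBall u R = g '' barlowStacking 2 𝗁 s ∩ closedBall u R`:
a centre `x ∈ V` of the ball is within `< 2` of some stacking point (`exists_dist_barlowPos_lt_two`,
moved by `g`), which is then a centre of `V` at distance `< R + 2` from `u`, hence equal to `x`.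
[folklore] -/
theorem inter_closedBall_eq_image_barlowStacking_inter {V : Set (EuclideanSpace ℝ (Fin 3))}
    (hV : IsUnitBallPacking V) (g : EuclideanSpace ℝ (Fin 3) ≃ᵢ EuclideanSpace ℝ (Fin 3))
    (s : ℤ → ℤ) {u : EuclideanSpace ℝ (Fin 3)} {R : ℝ}
    (hsub : ∀ y ∈ g '' barlowStacking 2 layerSpacing s, dist y u < R + 2 → y ∈ V) :
    V ∩ Metric.closedBall u R = g '' barlowStacking 2 layerSpacing s ∩ Metric.closedBall u R := by
  ext x
  simp only [Set.mem_inter_iff, Metric.mem_closedBall]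
  constructor
  · rintro ⟨hx, hxu⟩
    obtain ⟨k, i, j, hd⟩ := exists_dist_barlowPos_lt_two s (g.symm x)
    set y : EuclideanSpace ℝ (Fin 3) := g (barlowPos 2 layerSpacing s k i j) with hy
    have hyS : y ∈ g '' barlowStacking 2 layerSpacing s := ⟨_, barlowPos_mem k i j, rfl⟩
    have hxy : dist x y < 2 := by
      have : dist (g (g.symm x)) (g (barlowPos 2 layerSpacing s k i j)) < 2 := by
        rwa [g.dist_eq]
      simpa [hy] using this
    have hyu : dist y u < R + 2 := by
      have h1 : dist y u ≤ dist y x + dist x u := dist_triangle _ _ _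
      rw [dist_comm y x] at h1
      linarith
    have hyV : y ∈ V := hsub y hyS hyu
    have hxy' : x = y := hV hx hyV hxy
    exact ⟨hxy' ▸ hyS, hxu⟩
  · rintro ⟨hy, hyu⟩
    exact ⟨hsub x hy (by linarith), hyu⟩

/-- The same with the layer spacing written out, `2√(2/3)` (the normal form of the stub).
[folklore] -/
theorem inter_closedBall_eq_image_barlowStacking_inter' {V : Set (EuclideanSpace ℝ (Fin 3))}
    (hV : IsUnitBallPacking V) (g : EuclideanSpace ℝ (Fin 3) ≃ᵢ EuclideanSpace ℝ (Fin 3))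
    (s : ℤ → ℤ) {u : EuclideanSpace ℝ (Fin 3)} {R : ℝ}
    (hsub : ∀ y ∈ g '' barlowStacking 2 (2 * Real.sqrt (2 / 3)) s, dist y u < R + 2 → y ∈ V) :
    V ∩ Metric.closedBall u R =
      g '' barlowStacking 2 (2 * Real.sqrt (2 / 3)) s ∩ Metric.closedBall u R :=
  inter_closedBall_eq_image_barlowStacking_inter hV g s hsub

/-- **The finite-ball statement from a frame.**  If, after moving the packing by the isometry
`x ↦ p₀ + L x`, every point of the close-packed stacking `barlowStacking 2 𝗁 s` within distance
`< R + 2` of the moved centre `L⁻¹ (u − p₀)` is a centre, then `V ∩ closedBall u R` is the image of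
the stacking under `g = (p₀ + ·) ∘ L`, cut to the ball (`inter_closedBall_eq_image_barlowStacking_inter`).
This is the shape in which a layer-by-layer reconstruction delivers the conclusion of the stub
`stub_ballPropagation` (`R = 7`). [folklore] -/
theorem exists_isometry_inter_closedBall_eq_of_frame {V : Set (EuclideanSpace ℝ (Fin 3))}
    (hV : IsUnitBallPacking V) (p₀ : EuclideanSpace ℝ (Fin 3))
    (L : EuclideanSpace ℝ (Fin 3) ≃ₗᵢ[ℝ] EuclideanSpace ℝ (Fin 3)) (u : EuclideanSpace ℝ (Fin 3))
    (R : ℝ) {s : ℤ → ℤ} (hs : IsHaggSeq s)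
    (hsub : ∀ k i j : ℤ, dist (barlowPos 2 layerSpacing s k i j) (L.symm (u - p₀)) < R + 2 →
      p₀ + L (barlowPos 2 layerSpacing s k i j) ∈ V) :
    ∃ s : ℤ → ℤ, IsHaggSeq s ∧
      ∃ g : EuclideanSpace ℝ (Fin 3) ≃ᵢ EuclideanSpace ℝ (Fin 3),
        V ∩ Metric.closedBall u R =
          g '' barlowStacking 2 (2 * Real.sqrt (2 / 3)) s ∩ Metric.closedBall u R := by
  refine ⟨s, hs, L.toIsometryEquiv.trans (IsometryEquiv.addLeft p₀), ?_⟩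
  apply inter_closedBall_eq_image_barlowStacking_inter' hV
  rintro _ ⟨x, ⟨k, i, j, rfl⟩, rfl⟩ hd
  simp only [IsometryEquiv.trans_apply, IsometryEquiv.addLeft_apply,
    LinearIsometryEquiv.coe_toIsometryEquiv] at hd ⊢
  apply hsub
  have e : dist (barlowPos 2 layerSpacing s k i j) (L.symm (u - p₀)) =
      dist (p₀ + L (barlowPos 2 layerSpacing s k i j)) u := by
    rw [← L.dist_map, LinearIsometryEquiv.apply_symm_apply, ← dist_add_left p₀, add_sub_cancel]
  rw [e]; exact hd

/-- **Registered sub-goal `ballPropagation_nextShellAbove`** of the crux item (the upward step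
with types, in closed form): `exists_kissingShell_above_eq_layerShell`. [folklore] -/
theorem ballPropagation_nextShellAbove :
    ∀ (V : Set (EuclideanSpace ℝ (Fin 3))), Literature.Geometry.DiscreteGeometry.IsUnitBallPacking
    V → ∀ (σ σ' : ℝ), (σ = 1 ∨ σ = -1) → ∀ (p t : EuclideanSpace ℝ (Fin 3)),
    Literature.Geometry.DiscreteGeometry.kissingShell V p =
    Literature.Geometry.DiscreteGeometry.layerShell σ σ' → p ∈ V → t ∈
    Literature.Geometry.DiscreteGeometry.holeTriple σ → p + (3 : ℝ) • t ∈ V →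
    (Literature.Geometry.DiscreteGeometry.IsArrangedIn
    (Literature.Geometry.DiscreteGeometry.kissingShell V (p + (t +
    Literature.MathematicalPhysics.StatisticalMechanics.layerNormal
    Literature.Geometry.DiscreteGeometry.layerSpacing)))
    Literature.Geometry.DiscreteGeometry.fccKissingPattern ∨
    Literature.Geometry.DiscreteGeometry.IsArrangedIn
    (Literature.Geometry.DiscreteGeometry.kissingShell V (p + (t +
    Literature.MathematicalPhysics.StatisticalMechanics.layerNormal
    Literature.Geometry.DiscreteGeometry.layerSpacing)))
    Literature.Geometry.DiscreteGeometry.hcpKissingPattern) → ∃ τ : ℝ, (τ = 1 ∨ τ = -1) ∧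
    Literature.Geometry.DiscreteGeometry.kissingShell V (p + (t +
    Literature.MathematicalPhysics.StatisticalMechanics.layerNormal
    Literature.Geometry.DiscreteGeometry.layerSpacing)) =
    Literature.Geometry.DiscreteGeometry.layerShell τ (-σ) :=
  fun _ hV _ _ hσ _ _ hshell hp ht hfar hpat =>
    exists_kissingShell_above_eq_layerShell hV hσ hshell hp ht hfar hpat

end Summit.AtomisticToContinuum.Crystallization.Theorems

end
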